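import Literature.IUT.HodgeTheaters.KitNFSideCusps
import Literature.IUT.HodgeTheaters.KitNFSideNonVacuityWitness

/-!
# NV-L5 for the law `ZeroCuspInvariant` of the NF-side kit: it HOLDS for the toy `NFKit` ([IUTchI] Def 6.1 (v)) —
# post-freeze additive D13, proof-only, not a cone member

S. Mochizuki, *Inter-universal Teichmüller theory I*, kurims manuscript (May 2020), Definition 6.1 (v) p. 158
([IUTchI] Def 6.1 (v) p.158) [claim: Mochizuki2012, status: disputed] (claim key; one proof about abc-iut's own toy
objects; nothing of the series is asserted, no side is taken on [IUTchIII] Cor. 3.12).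

Over abc-iut-L5-t4's toy kit the covering seen at the place is the identity of `glob`, so an automorphism of the toy
`𝒟^{⊚±}` compatible with it is the identity of `AGL₁(𝔽_l)` and fixes every cusp; hence `ZeroCuspInvariant (NFKit.toy l)`
(DEGENERATE witness: the law is satisfiable jointly with all `NFKit` fields; `NV-L5 NFKit.ZeroCuspInvariant
WITNESSED decl PMBaseKit.NFKit.zeroCuspInvariant_toy [degenerate]`).
-/

namespace Literature.IUT.HodgeTheaters

open CategoryTheory

namespace PMBaseKit.NFKit

open Model

/-- **The law `ZeroCuspInvariant` holds for the toy NF kit** (degenerate NV witness). ([IUTchI] Def 6.1 (v) p.158) [claim: Mochizuki2012, status: disputed] -/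
theorem zeroCuspInvariant_toy (l : ℕ) [Fact l.Prime] (hl : l ≠ 2) : (NFKit.toy l hl).ZeroCuspInvariant := by
  intro α hα
  have h := hα ()
  change @HMul.hMul (AGL l) (AGL l) (AGL l) instHMul 1 α.hom = (1 : AGL l) at h
  have hα1 : @Eq (AGL l) α.hom 1 := by simpa using h
  have hmap : (toyKit l hl).gLabMap α = Equiv.refl _ := by
    change aglPerm l α.hom = _
    rw [hα1, map_one]
    rfl
  rw [hmap]
  rfl

end PMBaseKit.NFKit

end Literature.IUT.HodgeTheaters
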